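import Literature.Probability.Percolation.DependentStarPercolation
import Literature.Probability.Percolation.DualContours
import HarnessLib

/-!
# QUANT lane / PAPER-2 rate track (ARM-1, gen 2), Peierls lever P1: the NEAREST-NEIGHBOUR vertex boundary of a finite
# connected subset of `ℤ²` carries an anchored `★`-animal (edge-subdivision trick)

builds on p205010 (kernel theorem, internal audit signed; external expert review pending)

Cell `prim-quant`, seat `prim-quant-arm-1` (rate-theorem architect), memo `run/shared/lean/prim/quant/RATE-PLAN.md` §11.  Purpose: the
Peierls driver of Kozma–Nitzan's exploration process (`HSiteScheme.measure_initEvent_inter_finite_le`, threshold `ε ≤ 2⁻³²`, obtained from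
bond-dual circuits each of whose edges has SOME blocked endpoint, a loss `|X| ≥ n/4` and a `4ⁿ` sum over designated sets) is the one lossy constant
that feeds every tolerance of the explicit one-arm rate (`∂ log₂(1/η₃)/∂ log₂(1/ε) ≈ 144`, arm-2 RATE-CONSTANTS §2; consts row B7).  A vertex
Peierls argument needs a `★`-CONNECTED set of BLOCKED macro-vertices; the process blocks exactly the nearest-neighbour (NN) neighbours of its final
occupied cluster, while the tree's connectedness theorem (Friedli–Velenik Lemma B.82, `starConn_boundaries_starHull`) is about `★`-boundaries.
This file closes that gap by pure lattice geometry on `ℤ²`: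

* EDGE SUBDIVISION.  For a finite `A ⊂ ℤ²` let `B = 2A ∪ {2a + e : a, a + e ∈ A}` (doubled points and midpoints of NN-edges inside `A`); `B` is
  consumed through the membership hypothesis `hB` (no definition is introduced).  If `A` is NN-connected from `0` then `B` is `★`-connected
  (`starConn_subdivision`).
* THE PARITY LEMMA `exists_nnNeighbour`: if `y ∉ B` has a `★`-neighbour in `B` and a `★`-neighbour outside `B` other than itself, then some
  NN-boundary vertex `v = a + e ∉ A` (`a ∈ A`) satisfies `‖2v − y‖_∞ ≤ 1`.  (Cases on `y − 2c` for a corner `c ∈ A`: `(0,0)` impossible, `(±1,0)`/`(0,±1)`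
  midpoint slots, `(±1,±1)` unit squares; the square with all four corners in `A` is excluded because then all eight `★`-neighbours of `y` lie in `B`.)
* `exists_starAnimal_nnBoundary`: hence the exterior `★`-boundary `E` of the `★`-hull of `B` (which is `★`-connected, anchored on the positive axis within
  `#E`, and exterior) maps by `y ↦ v(y)` onto a `★`-connected set `T` of NN-boundary vertices of `A` (`‖y − y'‖_∞ ≤ 1 ⇒ ‖v − v'‖_∞ ≤ 1` since
  `‖2v − 2v'‖_∞ ≤ 3`), with `#E ≤ 9·#T` and an anchor `(j, 0) ∈ T`, `1 ≤ j ≤ 9·#T`: `T ∈ starAnimals (j e₀) (#T)`.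

Consumed by P2 (`…QuantPeierlsStarDriver.lean`): at a terminal time of a lawful exploration every NN-neighbour of the (finite) occupied cluster is
blocked, designated blocked sets cost `ε^{#T}`, and `Σ_t (9t+1)·100^{t−1} ε^t ≤ 2/3` for `ε ≤ 2⁻⁸` — the driver threshold moves from `2⁻³²` to `2⁻⁸`
(capacity of this count `≈ 1/140`), class of the rate unchanged, honest sentence unchanged.
[cite: FriedliVelenik2017, App. B.15, Lemma B.82] [cite: Timar2013, Thm. 3 (boundary connectivity in ℤ^d)] [cite: GrimmettPercolation1999, §1.4 pp. 15–18]
-/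

noncomputable section

namespace Summit.CriticalPhenomena.PercolationContinuityZ3.Theorems.Quant.StarPeierls

open Literature.Probability.LatticeModels Literature.Probability.Percolation Finset Relation
open Literature.Probability.Percolation.Contour (site_ext)

/-! ## Coordinates on `ℤ²` -/

/-- `‖x − y‖_∞ ≤ 1` on `ℤ²` in coordinates.
builds on p205010 (kernel theorem, internal audit signed; external expert review pending). [folklore] -/
theorem supDist_le_one_iff {x y : Site 2} : supDist x y ≤ 1 ↔ (x 0 - y 0).natAbs ≤ 1 ∧ (x 1 - y 1).natAbs ≤ 1 := by
  rw [supDist_le_iff, Fin.forall_fin_two]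

/-- `‖x − y‖_∞ ≤ 3` on `ℤ²` in coordinates.
builds on p205010 (kernel theorem, internal audit signed; external expert review pending). [folklore] -/
theorem supDist_le_three_iff {x y : Site 2} : supDist x y ≤ 3 ↔ (x 0 - y 0).natAbs ≤ 3 ∧ (x 1 - y 1).natAbs ≤ 3 := by
  rw [supDist_le_iff, Fin.forall_fin_two]

/-- The four unit steps of `ℤ²` in coordinates.
builds on p205010 (kernel theorem, internal audit signed; external expert review pending). [folklore] -/
theorem stepVec_cases (δ : Fin 2 × Bool) :
    (stepVec δ 0 = 1 ∧ stepVec δ 1 = 0) ∨ (stepVec δ 0 = -1 ∧ stepVec δ 1 = 0) ∨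
      (stepVec δ 0 = 0 ∧ stepVec δ 1 = 1) ∨ (stepVec δ 0 = 0 ∧ stepVec δ 1 = -1) := by
  obtain ⟨j, b⟩ := δ
  fin_cases j <;> cases b <;> simp [stepVec]

/-- A horizontal unit step with prescribed sign.
builds on p205010 (kernel theorem, internal audit signed; external expert review pending). [folklore] -/
theorem exists_stepVec_fst {σ : ℤ} (hσ : σ = 1 ∨ σ = -1) : ∃ δ : Fin 2 × Bool, stepVec δ 0 = σ ∧ stepVec δ 1 = 0 := by
  rcases hσ with rfl | rfl
  · exact ⟨((0 : Fin 2), true), by simp [stepVec]⟩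
  · exact ⟨((0 : Fin 2), false), by simp [stepVec]⟩

/-- A vertical unit step with prescribed sign.
builds on p205010 (kernel theorem, internal audit signed; external expert review pending). [folklore] -/
theorem exists_stepVec_snd {σ : ℤ} (hσ : σ = 1 ∨ σ = -1) : ∃ δ : Fin 2 × Bool, stepVec δ 0 = 0 ∧ stepVec δ 1 = σ := by
  rcases hσ with rfl | rfl
  · exact ⟨((1 : Fin 2), true), by simp [stepVec]⟩
  · exact ⟨((1 : Fin 2), false), by simp [stepVec]⟩

/-- A unit step is a `★`-step: `x ≠ x + e` and `‖e‖_∞ ≤ 1`.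
builds on p205010 (kernel theorem, internal audit signed; external expert review pending). [folklore] -/
theorem zdStar_adj_add_stepVec (x : Site 2) (δ : Fin 2 × Bool) : (zdStar 2).Adj x (x + stepVec δ) := by
  refine zdStar_adj.2 ⟨fun h => ?_, supDist_le_one_iff.2 ?_⟩
  · have h0 := congrFun h 0
    have h1 := congrFun h 1
    simp only [Pi.add_apply] at h0 h1
    rcases stepVec_cases δ with ⟨h0', h1'⟩ | ⟨h0', h1'⟩ | ⟨h0', h1'⟩ | ⟨h0', h1'⟩ <;> omega
  · simp only [Pi.add_apply]
    rcases stepVec_cases δ with ⟨h0', h1'⟩ | ⟨h0', h1'⟩ | ⟨h0', h1'⟩ | ⟨h0', h1'⟩ <;> omega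

/-! ## The edge subdivision `B = 2A ∪ midpoints` (through its membership hypothesis) -/

section Subdivision

variable {A B : Finset (Site 2)}
  (hB : ∀ y : Site 2, y ∈ B ↔ (∃ a ∈ A, y = a + a) ∨ ∃ a ∈ A, ∃ δ : Fin 2 × Bool, a + stepVec δ ∈ A ∧ y = a + a + stepVec δ)

include hB

/-- A point of `B` within `‖·‖_∞ ≤ 1` of `y` yields a CORNER of `y` in `A`: some `c ∈ A` with `‖2c − y‖_∞ ≤ 1`.
builds on p205010 (kernel theorem, internal audit signed; external expert review pending). [folklore] -/
theorem exists_corner {x y : Site 2} (hx : x ∈ B) (hxy : supDist x y ≤ 1) : ∃ c ∈ A, supDist (c + c) y ≤ 1 := by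
  rcases (hB x).1 hx with ⟨a, ha, rfl⟩ | ⟨a, ha, δ, ha', rfl⟩
  · exact ⟨a, ha, hxy⟩
  · by_cases hc : supDist (a + a) y ≤ 1
    · exact ⟨a, ha, hc⟩
    · refine ⟨a + stepVec δ, ha', ?_⟩
      rw [supDist_le_one_iff] at hxy hc ⊢
      simp only [Pi.add_apply] at hxy hc ⊢
      rcases stepVec_cases δ with ⟨h0, h1⟩ | ⟨h0, h1⟩ | ⟨h0, h1⟩ | ⟨h0, h1⟩ <;> omega

/-- **The parity lemma.**  If `y ∉ B` has a `★`-neighbour in `B` and a `★`-neighbour `z ≠ y` outside `B`, then some nearest-neighbour boundary vertex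
`v = a + e` of `A` (`a ∈ A`, `v ∉ A`) has `‖2v − y‖_∞ ≤ 1`.
builds on p205010 (kernel theorem, internal audit signed; external expert review pending). [folklore] -/
theorem exists_nnNeighbour {y : Site 2} (hyB : y ∉ B) (hin : ∃ x ∈ B, supDist x y ≤ 1)
    (hout : ∃ z, z ∉ B ∧ z ≠ y ∧ supDist z y ≤ 1) :
    ∃ a ∈ A, ∃ δ : Fin 2 × Bool, a + stepVec δ ∉ A ∧ supDist (a + stepVec δ + (a + stepVec δ)) y ≤ 1 := by
  obtain ⟨x, hxB, hxy⟩ := hin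
  obtain ⟨c, hcA, hc⟩ := exists_corner hB hxB hxy
  rw [supDist_le_one_iff] at hc
  simp only [Pi.add_apply] at hc
  have memB_dbl : ∀ a ∈ A, a + a ∈ B := fun a ha => (hB _).2 (Or.inl ⟨a, ha, rfl⟩)
  have memB_mid : ∀ a ∈ A, ∀ δ : Fin 2 × Bool, a + stepVec δ ∈ A → a + a + stepVec δ ∈ B :=
    fun a ha δ h => (hB _).2 (Or.inr ⟨a, ha, δ, h, rfl⟩)
  -- `σᵢ := y i − 2 c i ∈ {−1, 0, 1}`
  have h0 : y 0 - (c 0 + c 0) = 0 ∨ (y 0 - (c 0 + c 0) = 1 ∨ y 0 - (c 0 + c 0) = -1) := by omega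
  have h1 : y 1 - (c 1 + c 1) = 0 ∨ (y 1 - (c 1 + c 1) = 1 ∨ y 1 - (c 1 + c 1) = -1) := by omega
  rcases h0 with h0 | h0 <;> rcases h1 with h1 | h1
  · -- `y = 2c ∈ B`
    exfalso
    have : c + c = y := site_ext (by simp only [Pi.add_apply]; omega) (by simp only [Pi.add_apply]; omega)
    exact hyB (this ▸ memB_dbl c hcA)
  · -- `y = 2c ± e₁`: a vertical midpoint slot
    obtain ⟨δ₁, hδ₁0, hδ₁1⟩ := exists_stepVec_snd h1
    by_cases hA : c + stepVec δ₁ ∈ A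
    · exfalso
      have : c + c + stepVec δ₁ = y := site_ext (by simp only [Pi.add_apply]; omega) (by simp only [Pi.add_apply]; omega)
      exact hyB (this ▸ memB_mid c hcA δ₁ hA)
    · refine ⟨c, hcA, δ₁, hA, supDist_le_one_iff.2 ?_⟩
      simp only [Pi.add_apply]; omega
  · -- `y = 2c ± e₀`: a horizontal midpoint slot
    obtain ⟨δ₀, hδ₀0, hδ₀1⟩ := exists_stepVec_fst h0
    by_cases hA : c + stepVec δ₀ ∈ A
    · exfalso
      have : c + c + stepVec δ₀ = y := site_ext (by simp only [Pi.add_apply]; omega) (by simp only [Pi.add_apply]; omega)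
      exact hyB (this ▸ memB_mid c hcA δ₀ hA)
    · refine ⟨c, hcA, δ₀, hA, supDist_le_one_iff.2 ?_⟩
      simp only [Pi.add_apply]; omega
  · -- `y = 2c + (±1, ±1)`: the unit square with corners `c, c₁ = c ± e₀, c₂ = c ± e₁, c₃ = c₁ ± e₁`
    obtain ⟨δ₀, hδ₀0, hδ₀1⟩ := exists_stepVec_fst h0
    obtain ⟨δ₁, hδ₁0, hδ₁1⟩ := exists_stepVec_snd h1
    by_cases hA₁ : c + stepVec δ₀ ∈ A
    swap
    · refine ⟨c, hcA, δ₀, hA₁, supDist_le_one_iff.2 ?_⟩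
      simp only [Pi.add_apply]; omega
    by_cases hA₂ : c + stepVec δ₁ ∈ A
    swap
    · refine ⟨c, hcA, δ₁, hA₂, supDist_le_one_iff.2 ?_⟩
      simp only [Pi.add_apply]; omega
    by_cases hA₃ : c + stepVec δ₀ + stepVec δ₁ ∈ A
    swap
    · refine ⟨c + stepVec δ₀, hA₁, δ₁, hA₃, supDist_le_one_iff.2 ?_⟩
      simp only [Pi.add_apply]; omega
    -- all four corners in `A`: every `★`-neighbour of `y` lies in `B`, contradicting `hout`
    exfalso
    have hA₃' : c + stepVec δ₁ + stepVec δ₀ ∈ A := by rwa [add_right_comm]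
    obtain ⟨z, hzB, hzy, hz⟩ := hout
    rw [supDist_le_one_iff] at hz
    have hz0 : z 0 - (c 0 + c 0) = 0 ∨ z 0 - (c 0 + c 0) = stepVec δ₀ 0 ∨ z 0 - (c 0 + c 0) = 2 * stepVec δ₀ 0 := by omega
    have hz1 : z 1 - (c 1 + c 1) = 0 ∨ z 1 - (c 1 + c 1) = stepVec δ₁ 1 ∨ z 1 - (c 1 + c 1) = 2 * stepVec δ₁ 1 := by omega
    apply hzB
    rcases hz0 with hz0 | hz0 | hz0 <;> rcases hz1 with hz1 | hz1 | hz1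
    · have : c + c = z := site_ext (by simp only [Pi.add_apply]; omega) (by simp only [Pi.add_apply]; omega)
      exact this ▸ memB_dbl c hcA
    · have : c + c + stepVec δ₁ = z := site_ext (by simp only [Pi.add_apply]; omega) (by simp only [Pi.add_apply]; omega)
      exact this ▸ memB_mid c hcA δ₁ hA₂
    · have : c + stepVec δ₁ + (c + stepVec δ₁) = z :=
        site_ext (by simp only [Pi.add_apply]; omega) (by simp only [Pi.add_apply]; omega)
      exact this ▸ memB_dbl _ hA₂
    · have : c + c + stepVec δ₀ = z := site_ext (by simp only [Pi.add_apply]; omega) (by simp only [Pi.add_apply]; omega)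
      exact this ▸ memB_mid c hcA δ₀ hA₁
    · exact absurd (site_ext (by omega) (by omega)) hzy
    · have : c + stepVec δ₁ + (c + stepVec δ₁) + stepVec δ₀ = z :=
        site_ext (by simp only [Pi.add_apply]; omega) (by simp only [Pi.add_apply]; omega)
      exact this ▸ memB_mid _ hA₂ δ₀ hA₃'
    · have : c + stepVec δ₀ + (c + stepVec δ₀) = z :=
        site_ext (by simp only [Pi.add_apply]; omega) (by simp only [Pi.add_apply]; omega)
      exact this ▸ memB_dbl _ hA₁
    · have : c + stepVec δ₀ + (c + stepVec δ₀) + stepVec δ₁ = z :=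
        site_ext (by simp only [Pi.add_apply]; omega) (by simp only [Pi.add_apply]; omega)
      exact this ▸ memB_mid _ hA₁ δ₁ hA₃
    · have : c + stepVec δ₀ + stepVec δ₁ + (c + stepVec δ₀ + stepVec δ₁) = z :=
        site_ext (by simp only [Pi.add_apply]; omega) (by simp only [Pi.add_apply]; omega)
      exact this ▸ memB_dbl _ hA₃

/-- **`B` is `★`-connected** when `A` is NN-connected from the origin: every point of `B` is chained to `0` inside `B`
(`2u → 2u + e → 2(u + e)` for each NN-step `u → u + e` inside `A`; a midpoint hangs off its doubled endpoint).
builds on p205010 (kernel theorem, internal audit signed; external expert review pending). [folklore] -/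
theorem starConn_subdivision
    (hconn : ∀ a ∈ A, ReflTransGen (fun u v : Site 2 => (∃ δ : Fin 2 × Bool, v = u + stepVec δ) ∧ u ∈ A ∧ v ∈ A) 0 a) :
    StarConn (B : Set (Site 2)) := by
  have memB_dbl : ∀ a ∈ A, a + a ∈ B := fun a ha => (hB _).2 (Or.inl ⟨a, ha, rfl⟩)
  have memB_mid : ∀ a ∈ A, ∀ δ : Fin 2 × Bool, a + stepVec δ ∈ A → a + a + stepVec δ ∈ B :=
    fun a ha δ h => (hB _).2 (Or.inr ⟨a, ha, δ, h, rfl⟩)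
  -- doubled points are reachable from `0`
  have hdbl : ∀ a ∈ A, ReflTransGen (starRel (B : Set (Site 2))) 0 (a + a) := by
    intro a ha
    have key : ∀ w, ReflTransGen (fun u v : Site 2 => (∃ δ : Fin 2 × Bool, v = u + stepVec δ) ∧ u ∈ A ∧ v ∈ A) 0 w →
        ReflTransGen (starRel (B : Set (Site 2))) 0 (w + w) := by
      intro w h
      induction h with
      | refl => simpa using (ReflTransGen.refl : ReflTransGen (starRel (B : Set (Site 2))) 0 0)
      | @tail u v _ huv ih =>
        obtain ⟨⟨δ, rfl⟩, hu, hv⟩ := huv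
        have hm : u + u + stepVec δ ∈ B := memB_mid u hu δ hv
        have h1 : starRel (B : Set (Site 2)) (u + u) (u + u + stepVec δ) :=
          ⟨zdStar_adj_add_stepVec _ δ, mem_coe.2 (memB_dbl u hu), mem_coe.2 hm⟩
        have h2 : starRel (B : Set (Site 2)) (u + u + stepVec δ) (u + stepVec δ + (u + stepVec δ)) := by
          have heq : u + stepVec δ + (u + stepVec δ) = u + u + stepVec δ + stepVec δ := by abel
          rw [heq]
          exact ⟨zdStar_adj_add_stepVec _ δ, mem_coe.2 hm, mem_coe.2 (heq ▸ memB_dbl _ hv)⟩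
        exact (ih.tail h1).tail h2
    exact key a (hconn a ha)
  -- every point of `B` is reachable from `0`
  have hall : ∀ x ∈ B, ReflTransGen (starRel (B : Set (Site 2))) 0 x := by
    intro x hx
    rcases (hB x).1 hx with ⟨a, ha, rfl⟩ | ⟨a, ha, δ, ha', rfl⟩
    · exact hdbl a ha
    · exact (hdbl a ha).tail ⟨zdStar_adj_add_stepVec _ δ, mem_coe.2 (memB_dbl a ha), mem_coe.2 (memB_mid a ha δ ha')⟩
  intro x hx x' hx'
  exact (reflTransGen_starRel_symm (hall x (mem_coe.1 hx))).trans (hall x' (mem_coe.1 hx'))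

end Subdivision

/-! ## Exterior points have an outside `★`-neighbour -/

/-- A point of the exterior `★`-component of `Sᶜ` has a `★`-neighbour outside `S` other than itself (the component is unbounded).
builds on p205010 (kernel theorem, internal audit signed; external expert review pending). [folklore] -/
theorem exists_adj_not_mem_of_mem_starExt {S : Finset (Site 2)} {y : Site 2} (hy : y ∈ starExt S) :
    ∃ z, z ∉ S ∧ z ≠ y ∧ supDist z y ≤ 1 := by
  set R : ℕ := Finset.univ.sup fun i => (y i).natAbs with hR
  obtain ⟨-, w, hw, hyw⟩ := (mem_starExt_iff (le_refl 2) (subset_box_boxRadius S)).1 hy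
  obtain ⟨z', hz'far, hpath⟩ := exists_far_reflTransGen (le_refl 2) (subset_box_boxRadius S) R hw
  have hne : z' ≠ y := by
    intro h
    have hyfar : y ∈ farSet 2 R := h ▸ hz'far
    obtain ⟨i, hi⟩ := hyfar
    have : (y i).natAbs ≤ R := Finset.le_sup (f := fun i => (y i).natAbs) (Finset.mem_univ i)
    omega
  rcases (hyw.trans hpath).cases_head with h | ⟨c, hyc, -⟩
  · exact absurd h.symm hne
  · obtain ⟨hadj, -, hcS⟩ := hyc
    refine ⟨c, fun h => hcS (mem_coe.2 h), (zdStar_adj.1 hadj).1.symm, ?_⟩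
    rw [supDist_comm]
    exact (zdStar_adj.1 hadj).2

/-! ## `★`-connectedness of Lipschitz images -/

/-- The image of a `★`-connected finite set under a map that is `★`-Lipschitz on it is `★`-connected.
builds on p205010 (kernel theorem, internal audit signed; external expert review pending). [folklore] -/
theorem starConn_image {E : Finset (Site 2)} (hE : StarConn (E : Set (Site 2))) (φ : Site 2 → Site 2)
    (hφ : ∀ y ∈ E, ∀ y' ∈ E, supDist y y' ≤ 1 → supDist (φ y) (φ y') ≤ 1) :
    StarConn ((E.image φ : Finset (Site 2)) : Set (Site 2)) := by
  classical
  have key : ∀ y ∈ E, ∀ w, ReflTransGen (starRel (E : Set (Site 2))) y w →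
      ReflTransGen (starRel ((E.image φ : Finset (Site 2)) : Set (Site 2))) (φ y) (φ w) := by
    intro y _ w h
    induction h with
    | refl => exact ReflTransGen.refl
    | @tail b c _ hbc ih =>
      obtain ⟨hadj, hb, hc⟩ := hbc
      by_cases heq : φ b = φ c
      · rw [← heq]; exact ih
      · refine ih.tail ⟨zdStar_adj.2 ⟨heq, hφ b (mem_coe.1 hb) c (mem_coe.1 hc) (zdStar_adj.1 hadj).2⟩, ?_, ?_⟩
        · exact mem_coe.2 (mem_image_of_mem φ (mem_coe.1 hb))
        · exact mem_coe.2 (mem_image_of_mem φ (mem_coe.1 hc))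
  intro t ht t' ht'
  obtain ⟨y, hy, rfl⟩ := mem_image.1 (mem_coe.1 ht)
  obtain ⟨y', hy', rfl⟩ := mem_image.1 (mem_coe.1 ht')
  exact key y hy y' (hE y (mem_coe.2 hy) y' (mem_coe.2 hy'))

/-! ## The anchored `★`-animal of nearest-neighbour boundary vertices -/

/-- **Main geometric theorem.**  Let `A ⊂ ℤ²` be finite, `0 ∈ A`, and NN-connected from `0` (every `a ∈ A` is reached from `0` by unit steps inside
`A`).  Then for some `t ≥ 1` and some `j ≤ 9t` there is a `★`-connected set `T ∋ (j, 0)` of `t` points (a member of `starAnimals (j e₀) t`) consisting of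
NEAREST-NEIGHBOUR BOUNDARY VERTICES of `A`: every `v ∈ T` lies outside `A` and is `v = a + e` for some `a ∈ A` and a unit step `e`.
builds on p205010 (kernel theorem, internal audit signed; external expert review pending).
[cite: FriedliVelenik2017, App. B.15, Lemma B.82] [cite: Timar2013, Thm. 3] -/
theorem exists_starAnimal_nnBoundary (A : Finset (Site 2)) (h0 : (0 : Site 2) ∈ A)
    (hconn : ∀ a ∈ A, ReflTransGen (fun u v : Site 2 => (∃ δ : Fin 2 × Bool, v = u + stepVec δ) ∧ u ∈ A ∧ v ∈ A) 0 a) :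
    ∃ t : ℕ, 1 ≤ t ∧ ∃ j ∈ Finset.range (9 * t + 1),
      ∃ T ∈ starAnimals (Pi.single (0 : Fin 2) (j : ℤ) : Site 2) t,
        ∀ v ∈ T, v ∉ A ∧ ∃ a ∈ A, ∃ δ : Fin 2 × Bool, v = a + stepVec δ := by
  classical
  -- the edge subdivision `B`
  set B : Finset (Site 2) := A.image (fun a => a + a) ∪
    ((A ×ˢ (Finset.univ : Finset (Fin 2 × Bool))).filter fun q => q.1 + stepVec q.2 ∈ A).image
      fun q => q.1 + q.1 + stepVec q.2 with hBdef
  have hB : ∀ y : Site 2, y ∈ B ↔ (∃ a ∈ A, y = a + a) ∨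
      ∃ a ∈ A, ∃ δ : Fin 2 × Bool, a + stepVec δ ∈ A ∧ y = a + a + stepVec δ := by
    intro y
    rw [hBdef, mem_union, mem_image, mem_image]
    constructor
    · rintro (⟨a, ha, hay⟩ | ⟨q, hq, hqy⟩)
      · exact Or.inl ⟨a, ha, hay.symm⟩
      · rw [mem_filter, mem_product] at hq
        exact Or.inr ⟨q.1, hq.1.1, q.2, hq.2, hqy.symm⟩
    · rintro (⟨a, ha, rfl⟩ | ⟨a, ha, δ, hδ, rfl⟩)
      · exact Or.inl ⟨a, ha, rfl⟩
      · exact Or.inr ⟨(a, δ), mem_filter.2 ⟨mem_product.2 ⟨ha, mem_univ _⟩, hδ⟩, rfl⟩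
  have h0B : (0 : Site 2) ∈ B := (hB 0).2 (Or.inl ⟨0, h0, by simp⟩)
  have hBconn : StarConn (B : Set (Site 2)) := starConn_subdivision hB hconn
  -- the exterior `★`-boundary `E` of the hull of `B`
  set E := KestenZhang.blockSurface 0 B with hEdef
  have hEeq : E = exBoundary (starHullFinset B) := by rw [hEdef, KestenZhang.blockSurface, blockCluster_zero]
  have hEconn : StarConn (E : Set (Site 2)) := by
    have h := (starConn_boundaries_starHull (le_refl 2) (S := KestenZhang.blockCluster 0 B)
      (by rw [blockCluster_zero]; exact hBconn)).1
    rw [blockCluster_zero] at h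
    rwa [hEeq]
  obtain ⟨j, hj1, hjE, hjmem⟩ := KestenZhang.exists_anchor_blockSurface (le_refl 2) 0 h0B
  -- every `y ∈ E` has a nearest-neighbour boundary vertex `v` of `A` with `‖2v − y‖ ≤ 1`
  have hmain : ∀ y ∈ E, ∃ v : Site 2, (v ∉ A ∧ ∃ a ∈ A, ∃ δ : Fin 2 × Bool, v = a + stepVec δ) ∧ supDist (v + v) y ≤ 1 := by
    intro y hy
    obtain ⟨hyB, x, hxB, hxy⟩ := KestenZhang.blockSurface_spec (le_refl 2) hy
    rw [blockCluster_zero] at hyB hxB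
    have hyext : y ∈ starExt B := by
      rw [hEeq] at hy
      have hyH := (mem_exBoundary.1 hy).1
      by_contra h
      exact hyH ((mem_starHullFinset (le_refl 2)).2 h)
    obtain ⟨a, ha, δ, hv, hdist⟩ :=
      exists_nnNeighbour hB hyB ⟨x, hxB, hxy⟩ (exists_adj_not_mem_of_mem_starExt hyext)
    exact ⟨a + stepVec δ, ⟨hv, a, ha, δ, rfl⟩, hdist⟩
  choose! φ hφ using hmain
  set T := E.image φ with hTdef
  -- `T` consists of boundary vertices
  have hTbd : ∀ v ∈ T, v ∉ A ∧ ∃ a ∈ A, ∃ δ : Fin 2 × Bool, v = a + stepVec δ := by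
    intro v hv
    obtain ⟨y, hy, rfl⟩ := mem_image.1 hv
    exact (hφ y hy).1
  -- `T` is `★`-connected
  have hTconn : StarConn (T : Set (Site 2)) := by
    refine starConn_image hEconn φ fun y hy y' hy' hyy' => ?_
    have h1 := (hφ y hy).2
    have h2 := (hφ y' hy').2
    rw [supDist_le_one_iff] at h1 h2 hyy' ⊢
    simp only [Pi.add_apply] at h1 h2
    omega
  -- `#E ≤ 9 · #T`
  have hET : E.card ≤ 9 * T.card := by
    have hsub : E ⊆ T.biUnion fun v => starBall (v + v) := by
      intro y hy
      exact mem_biUnion.2 ⟨φ y, mem_image_of_mem φ hy, mem_starBall.2 (hφ y hy).2⟩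
    calc E.card ≤ (T.biUnion fun v => starBall (v + v)).card := card_le_card hsub
      _ ≤ ∑ v ∈ T, (starBall (v + v)).card := card_biUnion_le
      _ = ∑ _v ∈ T, 9 := by
          refine sum_congr rfl fun v _ => ?_
          rw [card_starBall]; norm_num
      _ = 9 * T.card := by rw [sum_const, smul_eq_mul, mul_comm]
  -- the anchor: `v* = φ (j e₀) = (j', 0)` with `1 ≤ j' ≤ 9 · #T`
  set y₀ : Site 2 := Pi.single (⟨0, by omega⟩ : Fin 2) (j : ℤ) with hy₀
  have hy₀0 : y₀ 0 = j := by simp [hy₀]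
  have hy₀1 : y₀ 1 = 0 := by simp [hy₀]
  obtain ⟨⟨hvA, a₀, ha₀, δ₀, hva⟩, hvdist⟩ := hφ y₀ hjmem
  set v := φ y₀ with hvdef
  have hvT : v ∈ T := mem_image_of_mem φ hjmem
  have hTpos : 1 ≤ T.card := card_pos.2 ⟨v, hvT⟩
  rw [supDist_le_one_iff] at hvdist
  simp only [Pi.add_apply] at hvdist
  rw [hy₀0, hy₀1] at hvdist
  have hv1 : v 1 = 0 := by omega
  have hvne : v ≠ 0 := fun h => hvA (h ▸ h0)
  have hv0 : 1 ≤ v 0 := by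
    by_contra hlt
    have hv00 : v 0 = 0 := by omega
    exact hvne (site_ext (by simpa using hv00) (by simpa using hv1))
  have hv0' : v 0 ≤ 9 * T.card := by
    have : (j : ℤ) ≤ E.card := by exact_mod_cast hjE
    have : (E.card : ℤ) ≤ 9 * T.card := by exact_mod_cast hET
    omega
  refine ⟨T.card, hTpos, (v 0).toNat, mem_range.2 (by omega), T, ?_, hTbd⟩
  have hanchor : (Pi.single (0 : Fin 2) (((v 0).toNat : ℕ) : ℤ) : Site 2) = v := by
    have h : (((v 0).toNat : ℕ) : ℤ) = v 0 := by omega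
    refine site_ext ?_ ?_
    · simp [h]
    · simp [hv1]
  rw [hanchor]
  exact mem_starAnimals hvT hTconn

end Summit.CriticalPhenomena.PercolationContinuityZ3.Theorems.Quant.StarPeierls

end
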